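import Summits.BirchSwinnertonDyer.BirchSwinnertonDyer.Theorems.PrintCf2SplitBadTwoLocalPointIndexBridge
import Summits.BirchSwinnertonDyer.BirchSwinnertonDyer.Theorems.PrintCf2SplitBadTwoLocalPointsPadicTransport
import Summits.BirchSwinnertonDyer.BirchSwinnertonDyer.Theorems.PrintCf2SplitBadTwoDyadicTorsionStubEll
import Summits.BirchSwinnertonDyer.BirchSwinnertonDyer.Theorems.PrintCf2SplitBadTwoCMScalarAtVEndRing
import HarnessLib

/-!
# Crux `PrintCf2.SplitBadTwoRankOneOfFacts` (stmt-BirchSwinnertonDyer-20368), road α v10.3/v10.4, S3c input (F3) — (PI) OF THE PLAIN ROAD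
# ASSEMBLED: `hPI` of p680684 VERBATIM ⟸ (A) «`E(K)_v + 2^N E(K_v) = ℤ·P_v + E(K_v)[2] + 2^N E(K_v)`» ∧ (B) «`#E(K_v)[2] = 4`»

Cell `bsd-print-cf2`, EXTRA WIDTH seat `bsd-line-cf2-p1-w3` g10 (prover-bsd-line-cf2-p1-w3-g10-0); `--supports stmt-BirchSwinnertonDyer-20368`
(helper, Theses-free). HONEST FRAMING: nothing here closes the crux or a registered stub; BSD is not proved by any of this; no summit statement
is proved by this seat. No definition, no named fact, no `sorry`, no kit. beyond-print theorem: no.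

WHY. After -w8 g3's cut `SelmerLocImage.hcounts_of_pointIndex_of_pinning_of_finiteSha (hPI) (hPIN) (hShaFin) : hcounts` (p680684) and LEAD cut 16
(`restrictedControl_two_of_levelCounts`, p679366), S3c `stub_restrictedControl_two` hangs on (PI) ∧ (PIN) ∧ (ShaFin); (ShaFin) is -w6 g4's
`CMPrimes.finite_sha_two_primary_baseChange_of_frame` (p679960), (PIN)(b) is -w8 g3's `hPINb_holds` (p681392), (PIN)(a) is -w8 g3's file 7/8 on
this seat's `cmScalar_*` files (p679879/p680162/p681283/p681617). THIS FILE assembles **(PI) VERBATIM** — «`v₂ [E(K_v) : E(K)_v + 2^N E(K_v)] =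
ℓ + e₃([d]₂)` for `N ≫ 0`», `e₃ ≡ 0` — from the two displayed point-level inputs that -w6 g4 is landing (LEAD ASSIGN 2026-08-28T23:58:11Z,
`Theorems/PrintCf2SplitBadTwoLocalPointImageAtV.lean`):
* (A) `hA` — per frame, for `h₁ : W_K = (W_K)_K`: `∃ N₀, ∀ N ≥ N₀`, `(E(K) → E(K_v)).range ⊔ 2^N E(K_v) = (ℤ·P_v ⊔ E(K_v)[2]) ⊔ 2^N E(K_v)`
  (`P_v = Affine.Point.baseChange K K_v (congrEquiv h₁ (map (ofId ℚ K) P))`, -w2 g11's currency p680004);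
* (B) `hB` — per frame: `Nat.card E(K_v)[2] = 4`;
and the tree: -w2 g11 `LocalLineCount.index_zmultiples_baseChange_sup_sup_range_eq` (p680004: the index of `ℤ·P_v + C_t + 2^N E(K_v)` is `2^{ℓ.toNat}` for
every 2-power-torsion `C_t` with `#C_t = 4`, `E(K_v) ≅ E(ℚ₂)` along -w6 g3's `exists_surjective_padic_adicCompletion`), -w4 g6 `le_ell_of_smul_eq_quadraticTwist`
(`ℓ ≥ 0`). So `hPI_holds := hPI_of_rangeEq_of_cardTwoTorsion hA hB` the minute (A), (B) land.
presearch: not applicable (assembly of tree theorems). playbook: none fit.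

References: [SilvermanAEC2009] Prop. VII.6.3, VIII §1; [Agboola2007] §6 Prop. 6.10–6.11; [MilneADT2006] I §6 Prop. 6.9.
-/

noncomputable section

open scoped Classical

set_option linter.dupNamespace false
set_option autoImplicit false

open NumberField IsDedekindDomain Field WeierstrassCurve
open Literature.NumberTheory.EllipticCurves Literature.NumberTheory.EllipticCurves.GreenbergSelmer
open Literature.NumberTheory.EllipticCurves.Agboola2007
open Literature.NumberTheory.GaloisRepresentations

namespace Summit.BirchSwinnertonDyer.BirchSwinnertonDyer.Theorems.PrintCf2.LocalLineCount

open Summit.BirchSwinnertonDyer.BirchSwinnertonDyer.Theorems.PrintCf2.RestrictedSelmerPair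
open Summit.BirchSwinnertonDyer.BirchSwinnertonDyer.Theorems.PrintCf2.AdditiveAtSeven
open Summit.BirchSwinnertonDyer.BirchSwinnertonDyer.Theorems.PrintCf2.DyadicTorsion

/-- **(PI) OF THE PLAIN ROAD, VERBATIM (hypothesis `hPI` of `SelmerLocImage.hcounts_of_pointIndex_of_pinning_of_finiteSha`, p680684), from the
𝒪_K-combination (A) and the 2-torsion count (B)**, with `e₃ := 0`: `v₂ [E(K_v) : E(K)_v + 2^N E(K_v)] = ℓ` for all `N ≫ 0` on every S3c frame.
[cite: SilvermanAEC2009, Prop. VII.6.3 and VIII §1] [cite: Agboola2007, §6 Prop. 6.10–6.11] -/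
theorem hPI_of_rangeEq_of_cardTwoTorsion
    (hA : ∀ (d : ℤ), d ≠ 0 → Squarefree d → d % 4 ≠ 1 →
      ∀ (W : WeierstrassCurve ℚ) [W.IsElliptic] [W.IsGloballyMinimal] (C : WeierstrassCurve.VariableChange ℚ),
        C • W = cm7.quadraticTwist (d : ℚ) → W.analyticRank = 1 →
      ∀ (K : Type) [Field K] [NumberField K], IsImaginaryQuadratic K →
      ∀ (v vbar : HeightOneSpectrum (𝓞 K)),
        ((2 : ℕ) : 𝓞 K) ∈ v.asIdeal → ((2 : ℕ) : 𝓞 K) ∈ vbar.asIdeal → vbar ≠ v →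
      ∀ (π : (W.baseChange K).endRing), (π : AddMonoid.End (W.baseChange K).geomPoints) * π = π - 2 →
      ∀ (r : ℤ_[2]), r * r = r - 2 →
        (∀ τ ∈ GreenbergSelmer.inertia v, ∀ x : ↥((W.baseChange K).endEigenPrimaryTorsion 2 π r), τ • x = x ∨ τ • x = -x) →
      ∀ (P : W.toAffine.Point) (c₀ : ℕ) (ℓ : ℤ),
        ¬ IsOfFinAddOrder P →
        (∀ R : W.toAffine.Point, ∃ (k : ℤ) (T : W.toAffine.Point), IsOfFinAddOrder T ∧ R = k • P + T) →
        c₀ ≠ 0 → (W.baseChange ℚ_[2]).IsInReductionKernel (c₀ • W.toPadicPoint 2 P) →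
        ‖(W.baseChange ℚ_[2]).padicLogPoint (c₀ • W.toPadicPoint 2 P) / (c₀ : ℚ_[2])‖ = (2 : ℝ) ^ (-ℓ) →
      Finite (restrictedSelmerBase ↥((W.baseChange K).endEigenPrimaryTorsion 2 π r) 2 vbar) →
      ∀ h₁ : W.baseChange K = (W.baseChange K).baseChange K,
      ∃ N₀ : ℕ, ∀ N : ℕ, N₀ ≤ N →
        (Affine.Point.baseChange (W' := W.baseChange K) K (v.adicCompletion K)).range ⊔
            (zsmulAddGroupHom ((2 ^ N : ℕ) : ℤ) : ((W.baseChange K).baseChange (v.adicCompletion K)).toAffine.Point →+ _).range =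
          (AddSubgroup.zmultiples (Affine.Point.baseChange (W' := (W.baseChange K).toAffine) K (v.adicCompletion K)
              (Affine.Point.congrEquiv h₁ (Affine.Point.map (W' := W.toAffine) (Algebra.ofId ℚ K) P))) ⊔
            AddSubgroup.torsionBy ((W.baseChange K).baseChange (v.adicCompletion K)).toAffine.Point 2) ⊔
          (zsmulAddGroupHom ((2 ^ N : ℕ) : ℤ) : ((W.baseChange K).baseChange (v.adicCompletion K)).toAffine.Point →+ _).range)
    (hB : ∀ (d : ℤ), d ≠ 0 → Squarefree d → d % 4 ≠ 1 →
      ∀ (W : WeierstrassCurve ℚ) [W.IsElliptic] [W.IsGloballyMinimal] (C : WeierstrassCurve.VariableChange ℚ),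
        C • W = cm7.quadraticTwist (d : ℚ) → W.analyticRank = 1 →
      ∀ (K : Type) [Field K] [NumberField K], IsImaginaryQuadratic K →
      ∀ (v vbar : HeightOneSpectrum (𝓞 K)),
        ((2 : ℕ) : 𝓞 K) ∈ v.asIdeal → ((2 : ℕ) : 𝓞 K) ∈ vbar.asIdeal → vbar ≠ v →
      ∀ (π : (W.baseChange K).endRing), (π : AddMonoid.End (W.baseChange K).geomPoints) * π = π - 2 →
      ∀ (r : ℤ_[2]), r * r = r - 2 →
        (∀ τ ∈ GreenbergSelmer.inertia v, ∀ x : ↥((W.baseChange K).endEigenPrimaryTorsion 2 π r), τ • x = x ∨ τ • x = -x) →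
      Nat.card (AddSubgroup.torsionBy ((W.baseChange K).baseChange (v.adicCompletion K)).toAffine.Point 2) = 4) :
    ∃ e₃ : ℤ → ℤ → ℤ, ∀ (d : ℤ), d ≠ 0 → Squarefree d → d % 4 ≠ 1 →
      ∀ (W : WeierstrassCurve ℚ) [W.IsElliptic] [W.IsGloballyMinimal] (C : WeierstrassCurve.VariableChange ℚ),
        C • W = cm7.quadraticTwist (d : ℚ) → W.analyticRank = 1 →
      ∀ (K : Type) [Field K] [NumberField K], IsImaginaryQuadratic K →
      ∀ (v vbar : HeightOneSpectrum (𝓞 K)),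
        ((2 : ℕ) : 𝓞 K) ∈ v.asIdeal → ((2 : ℕ) : 𝓞 K) ∈ vbar.asIdeal → vbar ≠ v →
      ∀ (π : (W.baseChange K).endRing), (π : AddMonoid.End (W.baseChange K).geomPoints) * π = π - 2 →
      ∀ (r : ℤ_[2]), r * r = r - 2 →
        (∀ τ ∈ GreenbergSelmer.inertia v, ∀ x : ↥((W.baseChange K).endEigenPrimaryTorsion 2 π r), τ • x = x ∨ τ • x = -x) →
      ∀ (P : W.toAffine.Point) (c₀ : ℕ) (ℓ : ℤ),
        ¬ IsOfFinAddOrder P →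
        (∀ R : W.toAffine.Point, ∃ (k : ℤ) (T : W.toAffine.Point), IsOfFinAddOrder T ∧ R = k • P + T) →
        c₀ ≠ 0 → (W.baseChange ℚ_[2]).IsInReductionKernel (c₀ • W.toPadicPoint 2 P) →
        ‖(W.baseChange ℚ_[2]).padicLogPoint (c₀ • W.toPadicPoint 2 P) / (c₀ : ℚ_[2])‖ = (2 : ℝ) ^ (-ℓ) →
      Finite (restrictedSelmerBase ↥((W.baseChange K).endEigenPrimaryTorsion 2 π r) 2 vbar) →
      ∃ N₃ : ℕ, ∀ N : ℕ, N₃ ≤ N →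
        (padicValNat 2 (((Affine.Point.baseChange (W' := W.baseChange K) K (v.adicCompletion K)).range ⊔
          (zsmulAddGroupHom ((2 ^ N : ℕ) : ℤ) : ((W.baseChange K).baseChange (v.adicCompletion K)).toAffine.Point →+ _).range).index) : ℤ) =
          ℓ + e₃ (d % 2) ((d / (2 - d % 2)) % 8) := by
  refine ⟨fun _ _ ↦ 0, ?_⟩
  intro d hd0 hsq hd4 W _ _ C hC hrk K _ _ hK v vbar hv hvbar hne π hrel r hr hpin P c₀ ℓ hP hgen hc₀ hker hlog hfin
  haveI : Fact (Nat.Prime 2) := ⟨Nat.prime_two⟩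
  haveI : CharZero (v.adicCompletion K) := charZero_of_injective_algebraMap (algebraMap K (v.adicCompletion K)).injective
  -- `W_K = (W_K)_K` and `W_{K_v} = (W_K)_{K_v}` (all ring maps out of `ℚ` agree)
  have h₁ : W.baseChange K = (W.baseChange K).baseChange K := by
    change W.map (algebraMap ℚ K) = (W.map (algebraMap ℚ K)).map (algebraMap K K)
    rw [WeierstrassCurve.map_map, Subsingleton.elim ((algebraMap K K).comp (algebraMap ℚ K)) (algebraMap ℚ K)]
  have h₂ : W.baseChange (v.adicCompletion K) = (W.baseChange K).baseChange (v.adicCompletion K) := by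
    change W.map (algebraMap ℚ (v.adicCompletion K)) = (W.map (algebraMap ℚ K)).map (algebraMap K (v.adicCompletion K))
    rw [WeierstrassCurve.map_map, Subsingleton.elim ((algebraMap K (v.adicCompletion K)).comp (algebraMap ℚ K))
      (algebraMap ℚ (v.adicCompletion K))]
  -- (A), (B) on this frame
  obtain ⟨N₀, hN₀⟩ := hA d hd0 hsq hd4 W C hC hrk K hK v vbar hv hvbar hne π hrel r hr hpin P c₀ ℓ hP hgen hc₀ hker hlog hfin h₁
  have hB4 := hB d hd0 hsq hd4 W C hC hrk K hK v vbar hv hvbar hne π hrel r hr hpin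
  -- -w2 g11's index of `ℤ·P_v + E(K_v)[2] + 2^N E(K_v)`, along `ℚ₂ ↠ K_v`
  obtain ⟨φ, hφ⟩ := exists_surjective_padic_adicCompletion (K := K) hK.1 hvbar hv hne.symm
  obtain ⟨N₁, hN₁⟩ := index_zmultiples_baseChange_sup_sup_range_eq hd0 hsq hd4 W hC K (v.adicCompletion K) φ hφ h₁ h₂ hc₀ hker hlog
  refine ⟨max N₀ N₁, fun N hN ↦ ?_⟩
  have htors : ∀ c ∈ AddSubgroup.torsionBy ((W.baseChange K).baseChange (v.adicCompletion K)).toAffine.Point 2, ∃ k : ℕ, 2 ^ k • c = 0 := by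
    intro c hc
    refine ⟨1, ?_⟩
    have hc' : (2 : ℤ) • c = 0 := (Submodule.mem_torsionBy_iff (2 : ℤ) c).mp hc
    rw [pow_one, ← ofNat_zsmul]
    exact hc'
  rw [hN₀ N (le_of_max_le_left hN), hN₁ N (le_of_max_le_right hN) _ htors hB4, padicValNat.prime_pow, add_zero]
  -- `ℓ ≥ 0`
  have hℓ : (if d % 8 = 3 then (1 : ℤ) else 0) ≤ ℓ := le_ell_of_smul_eq_quadraticTwist d hd0 hsq hd4 W C hC P c₀ ℓ hc₀ hker hlog
  have hℓ0 : 0 ≤ ℓ := le_trans (by split_ifs <;> norm_num) hℓ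
  exact Int.toNat_of_nonneg hℓ0

end Summit.BirchSwinnertonDyer.BirchSwinnertonDyer.Theorems.PrintCf2.LocalLineCount

end
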